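import Summits.Parity.BatemanHorn.Theorems.SoloInformedMoebiusSWHypAux
import Literature.NumberTheory.Sieve.BombieriFriedlanderIwaniecPieces

/-!
# SoloInformedMoebiusSWHyp — the Möbius log-power pieces satisfy hypothesis (A₂) of
# Bombieri–Friedlander–Iwaniec (Siegel–Walfisz for `μ` in BFI's vendored form)

Solo unit `solo-Parity-informed` (ideation tier, informed mode), session 76; `paper.md` §20
(Theorem 20.1 = (F′), step (1b)), PLAN §60 (file F2), CLAIMS C144–C146.

The kernel project (F′) (PLAN §60) bounds the UNBALANCED part of the located twin sum
(`twinUnbalancedSum`, C120) by `o(x)`.  Its bilinear regime (1b) feeds the divisor-switched sums to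
Bombieri–Friedlander–Iwaniec's Theorem 0 (b) (`Literature.NumberTheory.Sieve.BombieriFriedlanderIwaniecTheorem0b_holds`,
PROVED in the tree from the large sieve), whose only hypothesis on the `n`-variable is (A₂) =
`BFI.SiegelWalfiszHyp N B Csw β`.  The sequences arising there are the MÖBIUS LOG-POWER PIECES

  `β = moebiusLogPiece j r₀ a b : n ↦ 𝟙[a < n ≤ b] 𝟙[(n, r₀) = 1] μ(n) (log n)^j`

(`j ∈ {0, 1, 2}` from `log²(e₁e₂) = Σ_j (2 choose j) log^{2−j} e₁ log^j e₂`; `r₀ = 2` for the odd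
`n ≤ x`, `r₀ = 1` for the even ones).  This file PROVES, with no hypothesis, that every such piece
supported in `(N, 2N]` satisfies `BFI.SiegelWalfiszHyp N 2 Csw β` with ONE family of constants
`Csw = Csw(j, r₀)` independent of `N, a, b` (`siegelWalfiszHyp_moebiusLogPiece`).  Inputs, all PROVED
Literature theorems: the Siegel–Walfisz theorem for `μ`
(`Literature.NumberTheory.LFunctions.SiegelWalfiszMoebius_holds`) in Polymath 8a's uniform form with a
coprimality condition (`Polymath8a.sum_moebius_coprime_progression_le_uniform`), partial summation
against `log` (`BVMoebius.abs_sum_Ioc_mul_log_le`, iterated here to `log^j`), the trivial and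
large-moduli bounds of `BombieriFriedlanderIwaniecSiegelWalfisz.lean`, and the divisor bound
`τ(k) ≤ C k^{1/2}`.  Template: `RoughCellsAP.siegelWalfiszHyp_primePiece` (prime pieces, `B = 1`).

Structure of the proof (for `A > 0`, modulus `k`, cofactor `d`, `L = log 2N`, `Z = ‖β‖²`):
* small `N < N₁(A, j)`: `|Δ| ≤ 2 Σ|β| ≤ 4 ‖β‖ N^{1/2}` and `L^A ≤ L₁`;
* sparse pieces `Z ≤ N L^{−2A}`: `|Δ| ≤ 2 Σ|β| ≤ 2 Z ≤ 2 ‖β‖ N^{1/2} L^{−A}` (`|β_n| ≤ β_n²` as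
  `log n ≥ 1`);
* dense pieces, large moduli `k > L^{4A+2j}`: the trivial count `2N/k + 1 + (2N+1)/φ(k)` times
  `max |β| ≤ L^j`, with `1/φ(k) ≤ τ(k)/k ≤ C_τ k^{−1/2}`;
* dense pieces, small moduli `k ≤ L^{4A+2j}`: Siegel–Walfisz for `μ` with the coprimality
  conditions `(n, d r₀) = 1` resp. `(n, d k r₀) = 1` (saving `L^{10A+5j}`, cost `4^{ω(·)}`,
  `4^{ω(k)} ≤ k²`, `4^{ω(d)} ≤ τ(d)²`), and partial summation for the weight `log^j`.
The pieces, the iterated partial summation, the large-moduli count and the small-moduli bookkeeping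
are in `SoloInformedMoebiusSWHypAux.lean`; this file is the case analysis assembling them.
Deliberately NOT here: anything about the twin sum (files F1, F3–F5 of PLAN §60).
-/

namespace Summit.Parity.BatemanHorn.Theorems

open Finset Real Filter
open scoped ArithmeticFunction.Moebius ArithmeticFunction.sigma
open Literature.NumberTheory.Sieve Literature.NumberTheory.Sieve.BFI

/-! ### The theorem (sections 1–4 are in `SoloInformedMoebiusSWHypAux.lean`) -/

set_option maxHeartbeats 1600000 in
/-- **Möbius log-power pieces satisfy BFI's hypothesis (A₂)** (Siegel–Walfisz for `μ`, in the
vendored form `BFI.SiegelWalfiszHyp N 2 Csw`): for every `j` and `r₀ ≠ 0` there is ONE family of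
constants `Csw` such that for all `N ≥ 1` and all `a, b` with `N < a + 1`, `b ≤ 2N`, the piece
`β = 𝟙_{(a,b]} 𝟙_{(·,r₀)=1} μ log^j` satisfies `SiegelWalfiszHyp N 2 Csw β`.
[cite: BombieriFriedlanderIwaniecActa1986, §1 (A₂) p. 206; Polymath8a2014, Lemma 3.4 (iii)] -/
theorem siegelWalfiszHyp_moebiusLogPiece (j : ℕ) {r₀ : ℕ} (hr₀ : r₀ ≠ 0) :
    ∃ Csw : ℝ → ℝ, ∀ N : ℝ, 1 ≤ N → ∀ a b : ℕ, N < (a : ℝ) + 1 → (b : ℝ) ≤ 2 * N →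
      SiegelWalfiszHyp N 2 Csw (moebiusLogPiece j r₀ a b) := by
  suffices h : ∀ A : ℝ, ∃ C : ℝ, 0 < A → ∀ N : ℝ, 1 ≤ N → ∀ a b : ℕ, N < (a : ℝ) + 1 →
      (b : ℝ) ≤ 2 * N → ∀ d k : ℕ, 1 ≤ d → 1 ≤ k → ∀ l : ℤ, IsCoprime (k : ℤ) l →
        |(∑ n ∈ dyadic N, if (n : ZMod k) = (l : ZMod k) ∧ n.Coprime d then
              moebiusLogPiece j r₀ a b n else 0) -
            (∑ n ∈ dyadic N, if n.Coprime (d * k) then moebiusLogPiece j r₀ a b n else 0) /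
              (Nat.totient k : ℝ)| ≤
          C * Real.sqrt (l2Sq N (moebiusLogPiece j r₀ a b)) * N ^ (1 / 2 : ℝ) *
            (σ 0 d : ℝ) ^ (2 : ℝ) / Real.log (2 * N) ^ A by
    choose C hC using h
    exact ⟨C, fun N hN a b ha hb A hA d k hd hk l hl => hC A hA N hN a b ha hb d k hd hk l hl⟩
  intro A
  by_cases hA : 0 < A
  swap
  · exact ⟨0, fun h => absurd h hA⟩
  -- constants
  obtain ⟨CP, hCP0, hCP⟩ := Polymath8a.sum_moebius_coprime_progression_le_uniform
    Literature.NumberTheory.LFunctions.SiegelWalfiszMoebius_holds (A := 4 * A + 2 * j) (by positivity)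
    (B := 10 * A + 5 * j) (by positivity)
  obtain ⟨Cτ, hCτ1, hCτ⟩ := exists_sigma_zero_le_mul_rpow (ε := 1 / 2) (by norm_num)
  obtain ⟨N₁, hN₁1, hN₁⟩ := RoughCellsAP.exists_threshold_log (A + j / 2)
  set N₂ : ℝ := max N₁ 2 with hN₂
  have hN₂2 : 2 ≤ N₂ := le_max_right _ _
  set L₁ : ℝ := Real.log (2 * N₂) ^ A with hL₁
  have hL₁0 : 0 ≤ L₁ := Real.rpow_nonneg (Real.log_nonneg (by linarith)) _
  set Fr : ℝ := (4 : ℝ) ^ r₀.primeFactors.card with hFr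
  have hFr0 : 0 ≤ Fr := by positivity
  have hP0 : (0 : ℝ) ≤ 2 ^ (j + 3) * CP * Fr := by positivity
  set Cbig : ℝ := 4 * L₁ + 2 + (3 * Cτ + 3) + 2 ^ (j + 3) * CP * Fr with hCbig
  have hCbig0 : 0 ≤ Cbig := by rw [hCbig]; linarith
  refine ⟨Cbig, fun _ N hN a b ha hb d k hd hk l hl => ?_⟩
  -- basic facts
  have hN0 : 0 < N := by linarith
  have hlog0 : 0 < Real.log (2 * N) := Real.log_pos (by linarith)
  set L : ℝ := Real.log (2 * N) with hLdef
  set β : ℕ → ℝ := moebiusLogPiece j r₀ a b with hβdef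
  set Z : ℝ := l2Sq N β with hZdef
  have hZ0 : 0 ≤ Z := l2Sq_nonneg N β
  haveI : NeZero k := ⟨by omega⟩
  have hlu : IsUnit ((l : ℤ) : ZMod k) := (ZMod.unitOfIsCoprime l hl.symm).isUnit
  have hφ1 : (1 : ℝ) ≤ (Nat.totient k : ℝ) := by exact_mod_cast Nat.totient_pos.2 hk
  have hd0 : d ≠ 0 := by omega
  rw [← Finset.sum_filter, ← Finset.sum_filter]
  set D : ℝ := |(∑ n ∈ (dyadic N).filter (fun n : ℕ => (n : ZMod k) = ((l : ℤ) : ZMod k) ∧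
      n.Coprime d), β n) - (∑ n ∈ (dyadic N).filter (fun n : ℕ => n.Coprime (d * k)), β n) /
        (Nat.totient k : ℝ)| with hD
  -- the trivial bound `D ≤ 2 Σ|β| ≤ 4 √Z √N`
  have htriv : D ≤ 2 * ∑ n ∈ dyadic N, |β n| := abs_disc_le_two_sum_abs β hk _ d
  have hCS : ∑ n ∈ dyadic N, |β n| ≤ 2 * Real.sqrt Z * N ^ (1 / 2 : ℝ) := by
    refine (sum_abs_le_sqrt_l2Sq hN0.le β).trans ?_
    have h4 : Real.sqrt (2 * N + 1) ≤ 2 * N ^ (1 / 2 : ℝ) := by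
      rw [← Real.sqrt_eq_rpow]
      calc Real.sqrt (2 * N + 1) ≤ Real.sqrt (2 ^ 2 * N) := Real.sqrt_le_sqrt (by linarith)
        _ = 2 * Real.sqrt N := by rw [Real.sqrt_mul (by norm_num), Real.sqrt_sq (by norm_num)]
    calc Real.sqrt (l2Sq N β) * Real.sqrt (2 * N + 1) ≤ Real.sqrt Z * (2 * N ^ (1 / 2 : ℝ)) :=
          mul_le_mul_of_nonneg_left h4 (Real.sqrt_nonneg _)
      _ = 2 * Real.sqrt Z * N ^ (1 / 2 : ℝ) := by ring
  have htriv' : D ≤ 4 * Real.sqrt Z * N ^ (1 / 2 : ℝ) := by linarith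
  have hLA : 0 < L ^ A := Real.rpow_pos_of_pos hlog0 A
  have hsqN : 0 ≤ Real.sqrt Z * N ^ (1 / 2 : ℝ) := by positivity
  have hτ1 : (1 : ℝ) ≤ (σ 0 d : ℝ) ^ (2 : ℝ) :=
    Real.one_le_rpow (by exact_mod_cast one_le_sigma_zero hd0) (by norm_num)
  -- reduction: it suffices to bound `D L^A ≤ K τ(d)² √Z √N` with `K ≤ Cbig`
  rw [le_div_iff₀ hLA]
  have hgoalτ : ∀ K : ℝ, K ≤ Cbig →
      D * L ^ A ≤ K * (σ 0 d : ℝ) ^ (2 : ℝ) * (Real.sqrt Z * N ^ (1 / 2 : ℝ)) →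
      D * L ^ A ≤ Cbig * Real.sqrt (l2Sq N β) * N ^ (1 / 2 : ℝ) * (σ 0 d : ℝ) ^ (2 : ℝ) := by
    intro K hK h
    calc D * L ^ A ≤ K * (σ 0 d : ℝ) ^ (2 : ℝ) * (Real.sqrt Z * N ^ (1 / 2 : ℝ)) := h
      _ ≤ Cbig * (σ 0 d : ℝ) ^ (2 : ℝ) * (Real.sqrt Z * N ^ (1 / 2 : ℝ)) :=
          mul_le_mul_of_nonneg_right (mul_le_mul_of_nonneg_right hK (by positivity)) hsqN
      _ = _ := by rw [hZdef]; ring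
  have hgoal : ∀ K : ℝ, 0 ≤ K → K ≤ Cbig → D * L ^ A ≤ K * (Real.sqrt Z * N ^ (1 / 2 : ℝ)) →
      D * L ^ A ≤ Cbig * Real.sqrt (l2Sq N β) * N ^ (1 / 2 : ℝ) * (σ 0 d : ℝ) ^ (2 : ℝ) := by
    intro K hK0 hK h
    refine hgoalτ K hK (h.trans ?_)
    calc K * (Real.sqrt Z * N ^ (1 / 2 : ℝ)) = K * 1 * (Real.sqrt Z * N ^ (1 / 2 : ℝ)) := by
          rw [mul_one]
      _ ≤ K * (σ 0 d : ℝ) ^ (2 : ℝ) * (Real.sqrt Z * N ^ (1 / 2 : ℝ)) :=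
          mul_le_mul_of_nonneg_right (mul_le_mul_of_nonneg_left hτ1 hK0) hsqN
  by_cases hsmall : N < N₂
  · -- small `N`: `L^A ≤ L₁`
    have hLL₁ : L ^ A ≤ L₁ :=
      Real.rpow_le_rpow hlog0.le (Real.log_le_log (by linarith) (by linarith)) hA.le
    refine hgoal (4 * L₁) (by positivity) (by rw [hCbig]; linarith) ?_
    calc D * L ^ A ≤ (4 * Real.sqrt Z * N ^ (1 / 2 : ℝ)) * L₁ :=
          mul_le_mul htriv' hLL₁ hLA.le (by positivity)
      _ = 4 * L₁ * (Real.sqrt Z * N ^ (1 / 2 : ℝ)) := by ring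
  push Not at hsmall
  have hNN₁ : N₁ ≤ N := (le_max_left _ _).trans hsmall
  have hN2 : 2 ≤ N := hN₂2.trans hsmall
  obtain ⟨hL1, hL2A⟩ := hN₁ N hNN₁
  have hL2A0 : 0 < L ^ (2 * A) := Real.rpow_pos_of_pos hlog0 _
  by_cases hsparse : Z ≤ N / L ^ (2 * A)
  · -- sparse piece: `D ≤ 2 Σ|β| ≤ 2 Z ≤ 2 √Z √N / L^A`
    have hsumZ : ∑ n ∈ dyadic N, |β n| ≤ Z := by
      rw [hZdef, l2Sq]
      refine Finset.sum_le_sum fun n hn => abs_moebiusLogPiece_le_sq ?_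
      have hNn : N < n := ((mem_dyadic hN0.le).1 hn).1
      have hn3 : (3 : ℝ) ≤ n := by
        have h2n : (2 : ℝ) < n := by linarith
        have : 2 < n := by exact_mod_cast h2n
        exact_mod_cast this
      calc (1 : ℝ) = Real.log (Real.exp 1) := by rw [Real.log_exp]
        _ ≤ Real.log 3 := Real.log_le_log (Real.exp_pos 1) (by linarith [Real.exp_one_lt_d9])
        _ ≤ Real.log n := Real.log_le_log (by norm_num) hn3
    refine hgoal 2 (by norm_num) (by rw [hCbig]; linarith) ?_
    have h1 : Real.sqrt Z ≤ N ^ (1 / 2 : ℝ) / L ^ A := by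
      rw [← Real.sqrt_eq_rpow, Real.sqrt_le_left (by positivity), div_pow,
        ← RoughCellsAP.rpow_two_mul_eq_sq hlog0.le, Real.sq_sqrt hN0.le]
      exact hsparse
    calc D * L ^ A ≤ 2 * Z * L ^ A := mul_le_mul_of_nonneg_right (htriv.trans (by linarith)) hLA.le
      _ = 2 * (Real.sqrt Z * Real.sqrt Z) * L ^ A := by rw [Real.mul_self_sqrt hZ0]
      _ ≤ 2 * (Real.sqrt Z * (N ^ (1 / 2 : ℝ) / L ^ A)) * L ^ A := by gcongr
      _ = 2 * (Real.sqrt Z * N ^ (1 / 2 : ℝ)) := by field_simp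
  -- dense piece: an absolute bound `D ≤ K τ(d)² N / L^{2A}` suffices
  push Not at hsparse
  have hdens : N / L ^ (2 * A) ≤ Real.sqrt Z * N ^ (1 / 2 : ℝ) / L ^ A :=
    RoughCellsAP.div_rpow_le_sqrt_mul hN0.le hlog0 hsparse
  have habsτ : ∀ K : ℝ, 0 ≤ K → K ≤ Cbig → D ≤ K * (σ 0 d : ℝ) ^ (2 : ℝ) * (N / L ^ (2 * A)) →
      D * L ^ A ≤ Cbig * Real.sqrt (l2Sq N β) * N ^ (1 / 2 : ℝ) * (σ 0 d : ℝ) ^ (2 : ℝ) := by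
    intro K hK0 hK h
    refine hgoalτ K hK ?_
    calc D * L ^ A ≤ K * (σ 0 d : ℝ) ^ (2 : ℝ) * (N / L ^ (2 * A)) * L ^ A :=
          mul_le_mul_of_nonneg_right h hLA.le
      _ ≤ K * (σ 0 d : ℝ) ^ (2 : ℝ) * (Real.sqrt Z * N ^ (1 / 2 : ℝ) / L ^ A) * L ^ A := by gcongr
      _ = K * (σ 0 d : ℝ) ^ (2 : ℝ) * (Real.sqrt Z * N ^ (1 / 2 : ℝ)) := by field_simp
  have habs : ∀ K : ℝ, 0 ≤ K → K ≤ Cbig → D ≤ K * (N / L ^ (2 * A)) →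
      D * L ^ A ≤ Cbig * Real.sqrt (l2Sq N β) * N ^ (1 / 2 : ℝ) * (σ 0 d : ℝ) ^ (2 : ℝ) := by
    intro K hK0 hK h
    refine habsτ K hK0 hK (h.trans ?_)
    calc K * (N / L ^ (2 * A)) = K * 1 * (N / L ^ (2 * A)) := by rw [mul_one]
      _ ≤ K * (σ 0 d : ℝ) ^ (2 : ℝ) * (N / L ^ (2 * A)) :=
          mul_le_mul_of_nonneg_right (mul_le_mul_of_nonneg_left hτ1 hK0) (by positivity)
  by_cases hksmall : (k : ℝ) ≤ L ^ (4 * A + 2 * j)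
  · -- small moduli: Siegel–Walfisz for `μ` with coprimality conditions, partial summation
    -- the two sums as sums over `(a, b]`
    have hT₁ : ∑ n ∈ (dyadic N).filter (fun n : ℕ => (n : ZMod k) = ((l : ℤ) : ZMod k) ∧
          n.Coprime d), β n =
        ∑ n ∈ Ioc a b, (if ((n : ZMod k) = ((l : ℤ) : ZMod k) ∧ n.Coprime (d * r₀)) then
          (μ n : ℝ) else 0) * Real.log n ^ j := by
      rw [hβdef, sum_filter_dyadic_moebiusLogPiece hN0.le ha hb]
      refine Finset.sum_congr rfl fun n _ => ?_
      congr 1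
      refine if_congr ⟨fun h => ⟨h.1.1, Nat.Coprime.mul_right h.1.2 h.2⟩, fun h =>
        ⟨⟨h.1, (Nat.coprime_mul_iff_right.1 h.2).1⟩, (Nat.coprime_mul_iff_right.1 h.2).2⟩⟩ rfl rfl
    have hT₂ : ∑ n ∈ (dyadic N).filter (fun n : ℕ => n.Coprime (d * k)), β n =
        ∑ n ∈ Ioc a b, (if ((n : ZMod 1) = 0 ∧ n.Coprime (d * k * r₀)) then
          (μ n : ℝ) else 0) * Real.log n ^ j := by
      rw [hβdef, sum_filter_dyadic_moebiusLogPiece hN0.le ha hb]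
      refine Finset.sum_congr rfl fun n _ => ?_
      congr 1
      refine if_congr ⟨fun h => ⟨Subsingleton.elim _ _, Nat.Coprime.mul_right h.1 h.2⟩, fun h =>
        Nat.coprime_mul_iff_right.1 h.2⟩ rfl rfl
    -- the Siegel–Walfisz bounds for the partial sums (`x = 2N`)
    have h2N : (2 : ℝ) ≤ 2 * N := by linarith
    have hP₁ : ∀ t : ℕ, 1 ≤ t → t ≤ b →
        |∑ n ∈ (Icc 1 t).filter (fun n : ℕ => (n : ZMod k) = ((l : ℤ) : ZMod k) ∧
            n.Coprime (d * r₀)), (μ n : ℝ)| ≤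
          CP * (4 : ℝ) ^ (d * r₀).primeFactors.card * (2 * N) / L ^ (10 * A + 5 * j) := by
      intro t ht htb
      have htx : (t : ℝ) ≤ 2 * N := le_trans (by exact_mod_cast htb) hb
      have := hCP (2 * N) h2N k hk hksmall _ hlu (d * r₀) (mul_ne_zero hd0 hr₀) t
        (by exact_mod_cast ht) htx
      rwa [Nat.floor_natCast] at this
    have h1L : ((1 : ℕ) : ℝ) ≤ L ^ (4 * A + 2 * j) := by
      rw [Nat.cast_one]; exact Real.one_le_rpow hL1 (by positivity)
    have hP₂ : ∀ t : ℕ, 1 ≤ t → t ≤ b →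
        |∑ n ∈ (Icc 1 t).filter (fun n : ℕ => (n : ZMod 1) = 0 ∧ n.Coprime (d * k * r₀)),
            (μ n : ℝ)| ≤
          CP * (4 : ℝ) ^ (d * k * r₀).primeFactors.card * (2 * N) / L ^ (10 * A + 5 * j) := by
      intro t ht htb
      have htx : (t : ℝ) ≤ 2 * N := le_trans (by exact_mod_cast htb) hb
      have := hCP (2 * N) h2N 1 le_rfl h1L (0 : ZMod 1) (isUnit_of_subsingleton _) (d * k * r₀)
        (mul_ne_zero (mul_ne_zero hd0 (by omega)) hr₀) t (by exact_mod_cast ht) htx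
      rwa [Nat.floor_natCast] at this
    rcases le_or_gt a b with hab | hba
    · have hM₁0 : 0 ≤ CP * (4 : ℝ) ^ (d * r₀).primeFactors.card * (2 * N) / L ^ (10 * A + 5 * j) := by
        positivity
      have hM₂0 : 0 ≤ CP * (4 : ℝ) ^ (d * k * r₀).primeFactors.card * (2 * N) /
          L ^ (10 * A + 5 * j) := by positivity
      have h1 := abs_sum_Ioc_ite_moebius_log_pow_le hM₁0 hP₁ j hab
      have h2 := abs_sum_Ioc_ite_moebius_log_pow_le hM₂0 hP₂ j hab
      have hlogb : Real.log b ^ j ≤ L ^ j := by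
        refine pow_le_pow_left₀ (Real.log_natCast_nonneg b) ?_ j
        rcases Nat.eq_zero_or_pos b with rfl | hb0
        · simp [hlog0.le]
        · exact Real.log_le_log (by exact_mod_cast hb0) hb
      have h1' := h1.trans (mul_le_mul_of_nonneg_left hlogb (by positivity))
      have h2' := h2.trans (mul_le_mul_of_nonneg_left hlogb (by positivity))
      have hF₁ : (4 : ℝ) ^ (d * r₀).primeFactors.card ≤ (4 : ℝ) ^ d.primeFactors.card * Fr :=
        four_pow_card_primeFactors_mul_le d r₀
      have hF₂ : (4 : ℝ) ^ (d * k * r₀).primeFactors.card ≤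
          (4 : ℝ) ^ d.primeFactors.card * (k : ℝ) ^ 2 * Fr := by
        refine (four_pow_card_primeFactors_mul_le (d * k) r₀).trans ?_
        refine mul_le_mul_of_nonneg_right ?_ hFr0
        refine (four_pow_card_primeFactors_mul_le d k).trans ?_
        refine mul_le_mul_of_nonneg_left ?_ (by positivity)
        calc (4 : ℝ) ^ k.primeFactors.card ≤ (σ 0 k : ℝ) ^ 2 :=
              four_pow_card_primeFactors_le_sigma_zero_sq (by omega)
          _ ≤ (k : ℝ) ^ 2 := by
              gcongr
              rw [ArithmeticFunction.sigma_zero_apply]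
              exact_mod_cast Nat.card_divisors_le_self k
      have hK := small_moduli_bookkeeping' (T₁ := ∑ n ∈ Ioc a b, (if ((n : ZMod k) =
          ((l : ℤ) : ZMod k) ∧ n.Coprime (d * r₀)) then (μ n : ℝ) else 0) * Real.log n ^ j)
        (T₂ := ∑ n ∈ Ioc a b, (if ((n : ZMod 1) = 0 ∧ n.Coprime (d * k * r₀)) then
          (μ n : ℝ) else 0) * Real.log n ^ j)
        hL1 hA.le hN0.le hCP0 (by positivity : (0 : ℝ) ≤ (4 : ℝ) ^ d.primeFactors.card) hFr0
        (Nat.cast_nonneg k) hksmall hφ1 hF₁ hF₂ h1' h2'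
      refine habsτ (2 ^ (j + 3) * CP * Fr) (by positivity) (by rw [hCbig]; linarith) ?_
      rw [hD, hT₁, hT₂]
      refine hK.trans ?_
      have hFd : (4 : ℝ) ^ d.primeFactors.card ≤ (σ 0 d : ℝ) ^ (2 : ℝ) := by
        rw [show (2 : ℝ) = ((2 : ℕ) : ℝ) by norm_num, Real.rpow_natCast]
        exact four_pow_card_primeFactors_le_sigma_zero_sq hd0
      exact mul_le_mul_of_nonneg_right (mul_le_mul_of_nonneg_left hFd hP0) (by positivity)
    · -- `b < a`: the piece is empty
      refine habs 0 le_rfl hCbig0 ?_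
      rw [hD, hT₁, hT₂, Finset.Ioc_eq_empty (by omega), sum_empty, sum_empty]
      simp
  · -- large moduli: the trivial count with `max |β| ≤ L^j`
    push Not at hksmall
    have hMx : ∀ n ∈ dyadic N, |β n| ≤ L ^ j := fun n hn =>
      abs_moebiusLogPiece_le_log (pos_of_mem_dyadic hN0.le hn) ((mem_dyadic hN0.le).1 hn).2
    have hA' : 0 < A + j / 2 := by positivity
    have hkL : L ^ (4 * (A + j / 2)) < k := by
      rw [show 4 * (A + (j : ℝ) / 2) = 4 * A + 2 * j by ring]; exact hksmall
    have hlarge := disc_le_large_moduli_of_abs_le hN (by positivity) hMx hL1 hL2A hA' hCτ1 hCτ hk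
      hkL hlu d
    have hsimp : L ^ j * (N / L ^ (2 * (A + j / 2))) = N / L ^ (2 * A) := by
      rw [show 2 * (A + (j : ℝ) / 2) = 2 * A + j by ring, Real.rpow_add hlog0, Real.rpow_natCast]
      have hj0 : 0 < L ^ j := pow_pos hlog0 j
      field_simp
    refine habs (3 * Cτ + 3) (by positivity) (by rw [hCbig]; linarith) ?_
    calc D ≤ (3 * Cτ + 3) * L ^ j * (N / L ^ (2 * (A + j / 2))) := hlarge
      _ = (3 * Cτ + 3) * (N / L ^ (2 * A)) := by rw [mul_assoc, hsimp]

end Summit.Parity.BatemanHorn.Theorems
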